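import Summits.BirchSwinnertonDyer.BirchSwinnertonDyer.Theorems.ResidualThetaTransportAtTwoSignedMuSeedAtTwoPlusLayerZeroExact
import Summits.BirchSwinnertonDyer.BirchSwinnertonDyer.Theorems.ResidualThetaTransportAtTwoSignedMuSeedAtTwoPlusLayerGlue
import HarnessLib

/-!
# Seed crux `SignedMuSeedAtTwoPlus` (stmt-BirchSwinnertonDyer-21438) and Kμ⁺ `SignedMuVanishingAtTwoPlus` (stmt-BirchSwinnertonDyer-20689):
# the CLEAN-MEMBER CERTIFICATE — conj. 1 at a clean curve, the seed, conjunct 1 and the crux BY NAME from ONE upper count per class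

Cell `bsd-wall`, width seat `bsd-wall-rtt-p4-w3` (g3). THEOREMS ONLY (no `def`, no named fact, no `sorry`); every certificate is a
HYPOTHESIS; BSD is not proved by this. Assembly of this seat's `…LayerDual` (Selmer-currency certificate), `…LayerZeroExact` (exact
control at layer `0`: the `a = 1` count is `#Sel_{2^∞}(A/ℚ)[2]`) and `…LayerGlue` (seed / crux by name).

A curve `A/ℚ` is CLEAN here if it is globally minimal, good supersingular at `2` with `a₂(A) = 0`, `Sel_{2^∞}(A/ℚ)` is finite and
`2 ∤ ∏ c_ℓ(A)` (no Euler system, no `L`-value, no rank hypothesis is used; `Sel_{2^∞}(A/ℚ)` finite is e.g. a `2`-descent output).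

* **`isTorsion_and_mu_eq_zero_of_clean_of_card_lt`** — for clean `A`, the cyclotomic `κ`, a topological generator `γ`, ANY datum `D`
  of `Sel⁺(A/ℚ_∞)`: ONE layer `b ≥ 1` with `#{s ∈ Sel⁺(A/ℚ_∞) : 2s = 0, (conj_γ − 1)^b s = 0} < 2^{b−1} · #Sel_{2^∞}(A/ℚ)[2]` ⟹ `X⁺_A`
  is `Λ`-torsion with `μ⁺ = 0`. The right side is a `2`-descent count; the left side is the ONE remaining non-elementary input
  (an UPPER bound needs control at a higher layer — stubs S3/S4 of line `layer-rank-certificate`).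
* **`signedMuSeedAtTwoPlus_of_cleanCertificate`** — the seed child 21438 BY NAME from: every habitat⁺ `W` is congruent mod `2` to a
  clean `A` carrying such a count at every cyclotomic `(κ, γ)`; `muAlgebraic_of_cleanCertificate` (conjunct 1 of Kμ⁺ verbatim);
  `signedMuVanishingAtTwoPlus_of_cleanCertificate_of_analytic` (the crux BY NAME with the analytic child 21437).

References: [Kobayashi2003] Thm. 1.2, Thm. 9.3; [Fukuda1994] Thm. 1; [GreenbergVatsal2000] Prop. (2.8); [GreenbergLNM1716] §4 Lemmas 4.3–4.4.
-/

set_option autoImplicit false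
set_option linter.dupNamespace false

noncomputable section

open scoped Classical NumberField

open WeierstrassCurve Literature.NumberTheory.EllipticCurves Literature.NumberTheory.EllipticCurves.IwasawaAlgebra
  Literature.NumberTheory.EllipticCurves.Kobayashi2003 Literature.NumberTheory.EllipticCurves.Rank1Residual
  Literature.NumberTheory.EllipticCurves.IwasawaDual
  Summit.BirchSwinnertonDyer.BirchSwinnertonDyer.Theses.ResidualThetaTransportAtTwo

namespace Summit.BirchSwinnertonDyer.BirchSwinnertonDyer.Theorems.SignedMuAtTwo.LayerZero

/-- **Conj. 1 at a CLEAN curve from ONE upper count.** For `A/ℚ` globally minimal, good supersingular at `2` with `a₂(A) = 0`,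
`Sel_{2^∞}(A/ℚ)` finite and `2 ∤ ∏ c_ℓ(A)`, the cyclotomic `κ` with topological generator `γ`, and any Pontryagin-dual datum `D` of
`Sel⁺(A/ℚ_∞)`: if for some `b ≥ 1`
`#{s ∈ Sel⁺(A/ℚ_∞) : 2s = 0, (conj_γ − 1)^b s = 0} < 2^{b−1} · #Sel_{2^∞}(A/ℚ)[2]`,
then `X⁺_A` is `Λ`-torsion with `μ⁺ = 0`. (`LayerDual.isTorsion_and_mu_eq_zero_of_card_fixed_lt` with `a = 1`, whose count is the
`2`-descent count by `natCard_fixed_twoTorsion_eq_natCard_selmer_twoTorsion`.) [cite: Kobayashi2003, Thm. 9.3] [cite: Fukuda1994, Thm. 1] -/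
theorem isTorsion_and_mu_eq_zero_of_clean_of_card_lt (A : WeierstrassCurve ℚ) [A.IsElliptic] [A.IsGloballyMinimal]
    (hss : GoodSS A 2) (ha : A.frobeniusTrace 2 = 0) (hfin : Finite (A.selmerGroupPInfty 2)) (hTam : ¬ 2 ∣ A.tamagawaProduct)
    {κ : ZpExtension ℚ 2} (hκ : κ.IsCyclotomic) {γ : Field.absoluteGaloisGroup ℚ} (hγ : κ.IsTopGenerator γ)
    (D : SignedSelmerDualData A κ γ 1) {b : ℕ} (hb : 1 ≤ b)
    (h : Nat.card {s : signedSelmerInfty A κ 1 // 2 • s = 0 ∧ ((conjSignedSelmerInfty A κ 1 γ - 1) ^ b) s = 0} <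
      2 ^ (b - 1) * Nat.card {c : A.selmerGroupPInfty 2 // 2 • c = 0}) :
    Module.IsTorsion (IwasawaAlgebra 2) D.X ∧ D.mu = 0 := by
  rw [← natCard_fixed_twoTorsion_eq_natCard_selmer_twoTorsion A hss ha hκ hγ hfin hTam] at h
  refine LayerDual.isTorsion_and_mu_eq_zero_of_card_fixed_lt D hγ hb ?_
  simpa only [pow_one] using h

/-- **The seed child 21438 BY NAME from clean-member certificates**: every habitat⁺ `W` is congruent mod `2` (`W[2] ≃ A[2]`
Galois-equivariantly) to a CLEAN `A` (globally minimal, `GoodSS A 2`, `a₂(A) = 0`, `Sel_{2^∞}(A/ℚ)` finite, `2 ∤ ∏ c_ℓ(A)`; `A := W`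
is allowed when `W` is clean) such that at every cyclotomic `(κ, γ)` some layer `b ≥ 1` has
`#{s ∈ Sel⁺(A/ℚ_∞) : 2s = 0, (conj_γ − 1)^b s = 0} < 2^{b−1} · #Sel_{2^∞}(A/ℚ)[2]`. [cite: Kobayashi2003, Thm. 9.3]
[cite: Fukuda1994, Thm. 1] [cite: GreenbergVatsal2000, Prop. (2.8)] -/
theorem signedMuSeedAtTwoPlus_of_cleanCertificate
    (hcert : ∀ (W : WeierstrassCurve ℚ) [W.IsElliptic] [W.IsGloballyMinimal], ¬ W.HasCM → W.analyticRank = 0 →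
      GoodSS W 2 → W.frobeniusTrace 2 = 0 → W.Δ < 0 →
      ∃ (A : WeierstrassCurve ℚ) (_ : A.IsElliptic) (_ : A.IsGloballyMinimal), GoodSS A 2 ∧ A.frobeniusTrace 2 = 0 ∧
        (∃ e : WeierstrassCurve.geomTorsion W (2 : ℤ) ≃+ WeierstrassCurve.geomTorsion A (2 : ℤ),
          ∀ (σ : Field.absoluteGaloisGroup ℚ) (P : WeierstrassCurve.geomTorsion W (2 : ℤ)), e (σ • P) = σ • e P) ∧
        Finite (A.selmerGroupPInfty 2) ∧ ¬ 2 ∣ A.tamagawaProduct ∧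
        ∀ (κ : ZpExtension ℚ 2) (γ : Field.absoluteGaloisGroup ℚ), κ.IsCyclotomic → κ.IsTopGenerator γ →
          ∃ b : ℕ, 1 ≤ b ∧
            Nat.card {s : signedSelmerInfty A κ 1 // 2 • s = 0 ∧ ((conjSignedSelmerInfty A κ 1 γ - 1) ^ b) s = 0} <
              2 ^ (b - 1) * Nat.card {c : A.selmerGroupPInfty 2 // 2 • c = 0}) :
    SignedMuSeedAtTwoPlus := by
  intro W _ _ hCM hr hss ha hΔ
  obtain ⟨A, hAe, hAm, hssA, haA, hiso, hfinA, hTamA, hc⟩ := hcert W hCM hr hss ha hΔ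
  refine ⟨A, hAe, hAm, hssA, haA, hiso, fun κ γ hκ hγ D _ ↦ ?_⟩
  obtain ⟨b, hb, hlt⟩ := hc κ γ hκ hγ
  exact isTorsion_and_mu_eq_zero_of_clean_of_card_lt A hssA haA hfinA hTamA hκ hγ D hb hlt

/-- **Conjunct 1 of Kμ⁺ VERBATIM from clean-member certificates** (through the proved propagation, lead g3's
`muAlgebraic_iff_signedMuSeedAtTwoPlus`). [cite: GreenbergVatsal2000, Prop. (2.8)] [cite: Kobayashi2003, Thm. 9.3] -/
theorem muAlgebraic_of_cleanCertificate
    (hcert : ∀ (W : WeierstrassCurve ℚ) [W.IsElliptic] [W.IsGloballyMinimal], ¬ W.HasCM → W.analyticRank = 0 →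
      GoodSS W 2 → W.frobeniusTrace 2 = 0 → W.Δ < 0 →
      ∃ (A : WeierstrassCurve ℚ) (_ : A.IsElliptic) (_ : A.IsGloballyMinimal), GoodSS A 2 ∧ A.frobeniusTrace 2 = 0 ∧
        (∃ e : WeierstrassCurve.geomTorsion W (2 : ℤ) ≃+ WeierstrassCurve.geomTorsion A (2 : ℤ),
          ∀ (σ : Field.absoluteGaloisGroup ℚ) (P : WeierstrassCurve.geomTorsion W (2 : ℤ)), e (σ • P) = σ • e P) ∧
        Finite (A.selmerGroupPInfty 2) ∧ ¬ 2 ∣ A.tamagawaProduct ∧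
        ∀ (κ : ZpExtension ℚ 2) (γ : Field.absoluteGaloisGroup ℚ), κ.IsCyclotomic → κ.IsTopGenerator γ →
          ∃ b : ℕ, 1 ≤ b ∧
            Nat.card {s : signedSelmerInfty A κ 1 // 2 • s = 0 ∧ ((conjSignedSelmerInfty A κ 1 γ - 1) ^ b) s = 0} <
              2 ^ (b - 1) * Nat.card {c : A.selmerGroupPInfty 2 // 2 • c = 0}) :
    ∀ (W : WeierstrassCurve ℚ) [W.IsElliptic] [W.IsGloballyMinimal], ¬ W.HasCM → W.analyticRank = 0 →
      GoodSS W 2 → W.frobeniusTrace 2 = 0 → W.Δ < 0 →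
      ∀ (κ : ZpExtension ℚ 2) (γ : Field.absoluteGaloisGroup ℚ), κ.IsCyclotomic → κ.IsTopGenerator γ →
      ∀ (D : SignedSelmerDualData W κ γ 1) [Module.Finite (IwasawaAlgebra 2) D.X],
        Module.IsTorsion (IwasawaAlgebra 2) D.X ∧ D.mu = 0 :=
  muAlgebraic_iff_signedMuSeedAtTwoPlus.mpr (signedMuSeedAtTwoPlus_of_cleanCertificate hcert)

/-- **THE CRUX Kμ⁺ `SignedMuVanishingAtTwoPlus` BY NAME from {clean-member certificates, the analytic child 21437}.**
[cite: GreenbergVatsal2000, Prop. (2.8)] [cite: Pollack2003, Prop. 6.18] [cite: Kobayashi2003, Thm. 9.3] -/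
theorem signedMuVanishingAtTwoPlus_of_cleanCertificate_of_analytic (hAn : SignedMuAnalyticAtTwoPlus)
    (hcert : ∀ (W : WeierstrassCurve ℚ) [W.IsElliptic] [W.IsGloballyMinimal], ¬ W.HasCM → W.analyticRank = 0 →
      GoodSS W 2 → W.frobeniusTrace 2 = 0 → W.Δ < 0 →
      ∃ (A : WeierstrassCurve ℚ) (_ : A.IsElliptic) (_ : A.IsGloballyMinimal), GoodSS A 2 ∧ A.frobeniusTrace 2 = 0 ∧
        (∃ e : WeierstrassCurve.geomTorsion W (2 : ℤ) ≃+ WeierstrassCurve.geomTorsion A (2 : ℤ),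
          ∀ (σ : Field.absoluteGaloisGroup ℚ) (P : WeierstrassCurve.geomTorsion W (2 : ℤ)), e (σ • P) = σ • e P) ∧
        Finite (A.selmerGroupPInfty 2) ∧ ¬ 2 ∣ A.tamagawaProduct ∧
        ∀ (κ : ZpExtension ℚ 2) (γ : Field.absoluteGaloisGroup ℚ), κ.IsCyclotomic → κ.IsTopGenerator γ →
          ∃ b : ℕ, 1 ≤ b ∧
            Nat.card {s : signedSelmerInfty A κ 1 // 2 • s = 0 ∧ ((conjSignedSelmerInfty A κ 1 γ - 1) ^ b) s = 0} <
              2 ^ (b - 1) * Nat.card {c : A.selmerGroupPInfty 2 // 2 • c = 0}) :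
    SignedMuVanishingAtTwoPlus :=
  signedMuVanishingAtTwoPlus_of_analytic_of_seed hAn (signedMuSeedAtTwoPlus_of_cleanCertificate hcert)

end Summit.BirchSwinnertonDyer.BirchSwinnertonDyer.Theorems.SignedMuAtTwo.LayerZero

end
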